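import Summits.BirchSwinnertonDyer.BirchSwinnertonDyer.Theses.PrintX6
import Summits.BirchSwinnertonDyer.BirchSwinnertonDyer.Theorems.PrintX6KobayashiUpperHalf
import Summits.BirchSwinnertonDyer.Rank1Residual.Supersingular.X6RankZeroWitness22678e1LowerHalf
import HarnessLib

/-!
# Route `PrintX6`, leaf A6: the census cell `(22678e1, p = 5)` CLOSED ON THE ROUTE'S OWN TRUST BASE — `BSD(E,5)` from
# `PublishedInputsX6` (upper half = the PROVED item `UpperHalfX6`) + Cremona–Mazur visibility + Cassels–Tate (lower half),
# NO Wuthrich Prop. 21 (cell `bsd-print-x6`, seat p4 gen 1; `--supports` crux `EisensteinHalfFiveLe` as helper, closes no item)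

PARTITION currency (D-0054): leaf A6 = X6 ∧ r_an = 0; ONE cell (the A6 census cell of record at p ≥ 5, PROVED-by-name since
referee A R318 through `bsdp_x6r0visblt_22678e1_5`, whose upper half is Wuthrich 2014 Prop. 21, provenance flag R-WU14-P21-SS);
per pair; BEYOND-PRINT THEOREM: **NO**.

This file composes two landed pieces: the hW-free LOWER half at the cell
(`X6RankZero.missingLowerBoundAt_cell_22678e1_at5`, `Rank1Residual/Supersingular/X6RankZeroWitness22678e1LowerHalf.lean`:
visibility of `(ℤ/5)² ↪ Ш(E)[5]` in `E × F`, `F = 430882i1` of rank 2, Fisher's Hesse certificate for the `5`-congruence,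
Cremona–Mazur/Fisher local conditions decided in the kernel, Cassels–Tate; binders `hCT hGZK hϖ hU hU2 hF44 hF13`, models,
newform, enclosure) and the route's UPPER half (`X6.missingUpperBoundAt_rankZero_of_thm41` = item `UpperHalfX6`'s chain:
Kobayashi 2003 Thm 4.1 integral clause / Thm 1.2 + B. D. Kim 2013 Cor 3.15 + period units + Pollack + modularity + GZK, i.e.
conjuncts of `PublishedInputsX6`; `p`-adic surjectivity at 5 automatic on X6). `hϖ` and `hGZK` ARE conjuncts 4 and 9 of the
inputs, so the binders are exactly: `PublishedInputsX6`, Cassels–Tate, Tate uniformisation ×2, Fisher Thm 4.4, Fisher Thm 13.2,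
the two minimal models, the newform `f`/`hf`, and the engine's level-one enclosure `hball0` of `3·L(E,1)/ω₁ = 1250`
(kit j202394 / j256108). `ClassX6 W 5` and `r_an = 0` are derived (integer model + point count; the enclosure + modularity).

References: [Kobayashi2003] Thm 1.2/4.1; [BDKim2013] Cor 3.15; [CremonaMazur2000] §3; [Fisher2016Visualizing7] Thm 4.4;
[Fisher2012Hessian] Thm 13.2; [SilvermanAEC2009] X.4.14; [Miller2011LMS] Def 1.1; HOME/PLAN.md v2 p4 (W)/(ii).
-/

set_option autoImplicit false
set_option linter.dupNamespace false

noncomputable section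

open scoped Classical MatrixGroups ModularForm

open CongruenceSubgroup WeierstrassCurve Literature.NumberTheory.EllipticCurves
  Literature.NumberTheory.EllipticCurves.Rank1Residual
  Literature.NumberTheory.EllipticCurves.Rank1Residual.Typed
  Literature.NumberTheory.EllipticCurves.Fisher2016
  Literature.NumberTheory.EllipticCurves.Fisher2012
  Literature.NumberTheory.EllipticCurves.ModularForms
  Summit.BirchSwinnertonDyer.BirchSwinnertonDyer.Rank1Residual.IntModel
  Summit.BirchSwinnertonDyer.Rank1Residual.X11b
  Summit.BirchSwinnertonDyer.Rank1Residual.Supersingular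
  Summit.BirchSwinnertonDyer.BirchSwinnertonDyer.Theses.PrintX6

namespace Summit.BirchSwinnertonDyer.BirchSwinnertonDyer.Theorems.PrintX6

/-- **`BSD(E,5)` for `E = 22678e1` on the route's trust base — no Wuthrich Prop. 21.** Binders: the route's input pack
`PublishedInputsX6` (upper half via `X6.missingUpperBoundAt_rankZero_of_thm41`; its conjunct 4 is the period comparison `hϖ`
and conjunct 9 is GZK, both re-used by the lower half), Cassels–Tate `hCT`, Tate uniformisation `hU`/`hU2`, Fisher Thm 4.4
`hF44`, Fisher Thm 13.2 `hF13`, the minimal models of `E` and of its rank-2 `5`-congruent partner `F = 430882i1`, the newform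
`f`/`hf`, the engine's enclosure `hball0`. Lower half: `X6RankZero.missingLowerBoundAt_cell_22678e1_at5` (visibility + CT);
`ClassX6 W 5` from the integer model (`classX6_of_intModel`, `card_c22678e1_5`); `r_an = 0` from the enclosure (`L(E,1) = 0`
contradicts `|mid − 1250| ≤ 10⁻²⁰ ∧ |mid| ≤ 10⁻²⁰`) and modularity (conjunct 8); then the two halves and GZK
(`missingPPartAt_of_lower_of_upper`, `bsdp_of_missingPPartAt`). Per pair; not a class theorem.
[cite: Kobayashi2003, Thm. 4.1 (p. 8) and Thm. 1.2 (p. 2)] [cite: BDKim2013, Cor. 3.15 (p. 199)] [cite: CremonaMazur2000, §3]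
[cite: Fisher2016Visualizing7, Thm. 4.4] [cite: Fisher2012Hessian, Thm. 13.2] [cite: SilvermanAEC2009, Thm. X.4.14]
[cite: Miller2011LMS, §1 and Def. 1.1] -/
theorem X6.bsdp_22678e1_at5_of_publishedInputsX6 (hPub : PublishedInputsX6)
    (hCT : exists_casselsTate_pairing (K := ℚ))
    (hU : Silverman1994_thmV53_tateUniformisation.{0})
    (hU2 : Silverman1994_thmV53_corV54_tateUniformisation.{0})
    (hF44 : thm44_selmerLocalKer_iff_of_nonsplit_good) (hF13 : thm132_fiveCongruent_hessePencil)
    {W F : WeierstrassCurve ℚ} [W.IsElliptic] [W.IsGloballyMinimal] [F.IsElliptic] [F.IsGloballyMinimal]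
    (hWeq : W = ⟨1, 0, 0, 3140254662, -139987982322460⟩) (hFeq : F = ⟨1, 0, 0, -14128, -645920⟩)
    {N : ℕ} [NeZero N] (f : CuspForm (Gamma0 N) 2) (hf : IsNewformOf W f)
    (hball0 : ∃ mid rad : ℝ, rad ≤ 1 / 10 ^ (20 : ℕ) ∧ |mid - ((1250 : ℤ) : ℝ)| ≤ 1 / 10 ^ (20 : ℕ) ∧
      |((3 : ℕ) : ℝ) * (((1 : ℕ) : ℝ) * ((W.entireLFunction 1).re / plusPeriod f)) - mid| ≤ rad) :
    BSDp W 5 := by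
  haveI : Fact (Nat.Prime 5) := ⟨by norm_num⟩
  obtain ⟨h12, h41, hKim, hϖ, h3, -, hmod, hmod', hGZK⟩ := hPub
  -- the class predicate at 5 from the integer model
  have hIW : integralModelInt W = ⟨1, 0, 0, 3140254662, -139987982322460⟩ :=
    integralModelInt_eq_of_map_eq _ (by rw [hWeq]; ext <;> simp [WeierstrassCurve.map])
  have hX : ClassX6 W 5 :=
    classX6_of_intModel 5 le_rfl hIW (by decide +kernel) card_c22678e1_5 (by decide) (by decide +kernel)
  -- `r_an = 0` from the enclosure
  have hL : W.entireLFunction 1 ≠ 0 := by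
    obtain ⟨mid, rad, hrad, hmid, hball⟩ := hball0
    intro hL0
    rw [hL0] at hball
    simp only [Complex.zero_re, zero_div, mul_zero, zero_sub, abs_neg] at hball
    rw [abs_le] at hmid hball
    norm_num at hmid hball hrad
    linarith [hmid.1, hball.2]
  have hr0 : W.analyticRank = 0 := (W.analyticRank_eq_zero_iff_holds (hmod' W)).2 hL
  -- lower half (visibility + Cassels–Tate, hW-free) and upper half (the route's)
  have hlow : MissingLowerBoundAt W 5 :=
    X6RankZero.missingLowerBoundAt_cell_22678e1_at5 hCT hGZK hϖ hU hU2 hF44 hF13 hWeq hFeq f hf hball0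
  exact bsdp_of_missingPPartAt W 5 hGZK (by omega)
    (missingPPartAt_of_lower_of_upper W 5 hlow
      (X6.missingUpperBoundAt_rankZero_of_thm41 W 5 h41 h12 hKim hϖ h3 hmod hmod' hGZK (by norm_num) hX hr0))

end Summit.BirchSwinnertonDyer.BirchSwinnertonDyer.Theorems.PrintX6

end
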